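import Summits.ValiantsHypothesis.ValiantsHypothesis.Theorems.LacunarySymmetroidMatrixDescartesDoorA26WallBubblingTwoPairClusterRungs
import Summits.ValiantsHypothesis.ValiantsHypothesis.Theorems.LacunarySymmetroidMatrixDescartesDoorA26WallBubblingDoublyConfluentClusters
import Summits.ValiantsHypothesis.ValiantsHypothesis.Theorems.LacunarySymmetroidMatrixDescartesDoorA26WallBubblingDoublyConfluentSlots
import Summits.ValiantsHypothesis.ValiantsHypothesis.Theorems.LacunarySymmetroidMatrixDescartesDoorA26WallBubblingChainCeilingTight
import Summits.ValiantsHypothesis.ValiantsHypothesis.Theorems.LacunarySymmetroidMatrixDescartesDoorA26WallBubblingConfluentTower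
import Summits.ValiantsHypothesis.ValiantsHypothesis.Theorems.LacunarySymmetroidMatrixDescartesDoorA26WallBubblingTwoPairChainSplitB

/-!
# Wall bubbling for `DoorA26` — TWO WEYL PAIRS: THE CHAIN ASSEMBLED MODULO THE MIXED-CLASS RULES (no accumulation of twenties, door-free)

HONEST FRAMING.  Obligation (W) `stub_weylFaces` of `Cruxes/DoorA26/Lines/wall_bubbling.lean` (crux `DoorA26`, stmt-ValiantsHypothesis-19979; OPEN,
typed, never asserted); W1 seat val-sym-door-p2 g13 (#52) — the last step of the two-dslope port plan `HOME/val-sym-door-p2/g13/TWO-DSLOPE-CHAIN-PORT.md`.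
W2's tight chain (`…TightChain`) RUN AT A TWO-WEYL-PAIR POINT (pairs at `0,5` and `1,4`, singles `2,3`) over the two-dslope clusters (W1 #45), rungs
(W1 #46–#51), member-language count (W1 #37) and `chain_ceiling` (W2 #17): with `n = (3,3,3,2,2,2,2,1,1,1)` slots on the `≤ 10` values the ceiling
reads `Σ m_c ≤ 10 + 9 = 19 < 20` — a contradiction, with NO tightness analysis.  The ONE input not in the tree is the rung family of the MIXED CLASS
`δ₀+δ₁ = {(0,1) deg 0; (0,4),(5,1) deg 1; (5,4) deg 2}` (4 members, 3 slots): it enters as THREE EXPLICIT HYPOTHESES in two- and three-scale currency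
(door pattern; memo §2): `hMixTop` («`Γ 5 4 ≠ 0 → Γ' 5 4 = 0 ∧ Γ' 0 4 = 0 ∧ Γ' 5 1 = 0`»), `hMixMid` («`Γ 0 4 ≠ 0 ∨ Γ 5 1 ≠ 0 → Γ' 5 4 = 0`»),
`hMixThree` («a degree-1 member alive at three scales → False»), each with the frame hypotheses of `twoPair_twoScale_monotone` /
`twoPair_threeScale_triple₀₅` verbatim.  The coincidence pattern `hG` allows the trivial coincidences AND the wall patterns (c1) `{A,B}~{2,3}`,
(c2) `{A,2}~{B,3}` (classes `A = {0,5}`, `B = {1,4}`), so the theorem serves the value-generic stratum and both walls at once: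

* **`twoPair_noTwenties_of_mixedRules`** (slot splitting in W1 #52c/#52d `…TwoPairChainSplitA/B`, dictionary #52a/#52b) `(hMixTop) (hMixMid) (hMixThree) (δs δ0 hδ) (h50) (h41) (hG) (hnd) (U hU hne z hz hroot) : False`.

The corollaries hC1/hC2/hVG2 of W1 #43/#44 modulo the three mixed rules are immediate (`hnd` from W1 #26d/#26b/#26; `hG` by weakening `hgen`/`hvg`)
and left to the file that proves the mixed rules.  Registers unchanged; (W), `ConfluentDoor26`, `NoTightChain26(NC)`, `DoorA26` 19979, 18050 OPEN,
typed never asserted; nothing on VP ≠ VNP.  Def-free.  `--supports stmt-ValiantsHypothesis-19979 --as helper`.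
-/

-- `Summit.ValiantsHypothesis.ValiantsHypothesis.…` repeats a component by the D-0017 layout
-- (single-conjunct summit), which the `dupNamespace` linter flags; the name is mandated.
set_option linter.dupNamespace false

namespace Summit.ValiantsHypothesis.ValiantsHypothesis.Theorems.LacunarySymmetroidMatrixDescartes.WallBubbling

open Finset Filter Topology Polynomial
open Bubbling (polar polar_comm)
open Literature.Analysis.TotalPositivity.LaguerreRuleOfSigns (ZerosWithMultiplicityLE)
open scoped BigOperators

/-- **THE TWO-PAIR CHAIN, MODULO THE MIXED-CLASS RULES: NO TWENTIES ACCUMULATE AT A TWO-WEYL-PAIR POINT** (value-generic or on the walls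
(c1)/(c2); per-cluster non-degeneracy `hnd` as input; the three mixed-class rules as inputs).  See the module docstring. [this work] -/
theorem twoPair_noTwenties_of_mixedRules (δ0 : Fin 6 → ℝ) (h50 : δ0 5 = δ0 0) (h41 : δ0 4 = δ0 1)
    (hMixTop : ∀ (δs : ℕ → Fin 6 → ℝ), (∀ l, Tendsto (fun ν => δs ν l) atTop (𝓝 (δ0 l))) →
      ∀ (U : ℕ → Fin 6 → Matrix (Fin 2) (Fin 2) ℝ) (L : ℕ → ℝ), Tendsto L atTop atTop →
      ∀ (μ μ' : ℕ → ℝ), (∀ ν, 0 < μ ν) → (∀ ν, 0 < μ' ν) →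
      (∀ ν a b, |polar (if a = 0 then U ν 0 + U ν 5 else if a = 1 then U ν 1 + U ν 4
          else if a = 4 then (δs ν 4 - δs ν 1) • U ν 4 else if a = 5 then (δs ν 5 - δs ν 0) • U ν 5 else U ν a)
        (if b = 0 then U ν 0 + U ν 5 else if b = 1 then U ν 1 + U ν 4
          else if b = 4 then (δs ν 4 - δs ν 1) • U ν 4 else if b = 5 then (δs ν 5 - δs ν 0) • U ν 5 else U ν b)| ≤ μ ν) →
      (∀ ν a b, |polar (if a = 0 then Real.exp (δs ν 0 * L ν) • U ν 0 + Real.exp (δs ν 5 * L ν) • U ν 5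
          else if a = 1 then Real.exp (δs ν 1 * L ν) • U ν 1 + Real.exp (δs ν 4 * L ν) • U ν 4
          else if a = 4 then (δs ν 4 - δs ν 1) • (Real.exp (δs ν 4 * L ν) • U ν 4)
          else if a = 5 then (δs ν 5 - δs ν 0) • (Real.exp (δs ν 5 * L ν) • U ν 5) else Real.exp (δs ν a * L ν) • U ν a)
        (if b = 0 then Real.exp (δs ν 0 * L ν) • U ν 0 + Real.exp (δs ν 5 * L ν) • U ν 5
          else if b = 1 then Real.exp (δs ν 1 * L ν) • U ν 1 + Real.exp (δs ν 4 * L ν) • U ν 4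
          else if b = 4 then (δs ν 4 - δs ν 1) • (Real.exp (δs ν 4 * L ν) • U ν 4)
          else if b = 5 then (δs ν 5 - δs ν 0) • (Real.exp (δs ν 5 * L ν) • U ν 5) else Real.exp (δs ν b * L ν) • U ν b)| ≤ μ' ν) →
      ∀ (Γ Γ' : Fin 6 → Fin 6 → ℝ),
      (∀ a b, Tendsto (fun ν => polar (if a = 0 then U ν 0 + U ν 5 else if a = 1 then U ν 1 + U ν 4
          else if a = 4 then (δs ν 4 - δs ν 1) • U ν 4 else if a = 5 then (δs ν 5 - δs ν 0) • U ν 5 else U ν a)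
        (if b = 0 then U ν 0 + U ν 5 else if b = 1 then U ν 1 + U ν 4
          else if b = 4 then (δs ν 4 - δs ν 1) • U ν 4 else if b = 5 then (δs ν 5 - δs ν 0) • U ν 5 else U ν b) / μ ν) atTop (𝓝 (Γ a b))) →
      (∀ a b, Tendsto (fun ν => polar (if a = 0 then Real.exp (δs ν 0 * L ν) • U ν 0 + Real.exp (δs ν 5 * L ν) • U ν 5
          else if a = 1 then Real.exp (δs ν 1 * L ν) • U ν 1 + Real.exp (δs ν 4 * L ν) • U ν 4
          else if a = 4 then (δs ν 4 - δs ν 1) • (Real.exp (δs ν 4 * L ν) • U ν 4)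
          else if a = 5 then (δs ν 5 - δs ν 0) • (Real.exp (δs ν 5 * L ν) • U ν 5) else Real.exp (δs ν a * L ν) • U ν a)
        (if b = 0 then Real.exp (δs ν 0 * L ν) • U ν 0 + Real.exp (δs ν 5 * L ν) • U ν 5
          else if b = 1 then Real.exp (δs ν 1 * L ν) • U ν 1 + Real.exp (δs ν 4 * L ν) • U ν 4
          else if b = 4 then (δs ν 4 - δs ν 1) • (Real.exp (δs ν 4 * L ν) • U ν 4)
          else if b = 5 then (δs ν 5 - δs ν 0) • (Real.exp (δs ν 5 * L ν) • U ν 5) else Real.exp (δs ν b * L ν) • U ν b) / μ' ν) atTop (𝓝 (Γ' a b))) →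
      Γ 5 4 ≠ 0 → Γ' 5 4 = 0 ∧ Γ' 0 4 = 0 ∧ Γ' 5 1 = 0)
    (hMixMid : ∀ (δs : ℕ → Fin 6 → ℝ), (∀ l, Tendsto (fun ν => δs ν l) atTop (𝓝 (δ0 l))) →
      ∀ (U : ℕ → Fin 6 → Matrix (Fin 2) (Fin 2) ℝ) (L : ℕ → ℝ), Tendsto L atTop atTop →
      ∀ (μ μ' : ℕ → ℝ), (∀ ν, 0 < μ ν) → (∀ ν, 0 < μ' ν) →
      (∀ ν a b, |polar (if a = 0 then U ν 0 + U ν 5 else if a = 1 then U ν 1 + U ν 4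
          else if a = 4 then (δs ν 4 - δs ν 1) • U ν 4 else if a = 5 then (δs ν 5 - δs ν 0) • U ν 5 else U ν a)
        (if b = 0 then U ν 0 + U ν 5 else if b = 1 then U ν 1 + U ν 4
          else if b = 4 then (δs ν 4 - δs ν 1) • U ν 4 else if b = 5 then (δs ν 5 - δs ν 0) • U ν 5 else U ν b)| ≤ μ ν) →
      (∀ ν a b, |polar (if a = 0 then Real.exp (δs ν 0 * L ν) • U ν 0 + Real.exp (δs ν 5 * L ν) • U ν 5
          else if a = 1 then Real.exp (δs ν 1 * L ν) • U ν 1 + Real.exp (δs ν 4 * L ν) • U ν 4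
          else if a = 4 then (δs ν 4 - δs ν 1) • (Real.exp (δs ν 4 * L ν) • U ν 4)
          else if a = 5 then (δs ν 5 - δs ν 0) • (Real.exp (δs ν 5 * L ν) • U ν 5) else Real.exp (δs ν a * L ν) • U ν a)
        (if b = 0 then Real.exp (δs ν 0 * L ν) • U ν 0 + Real.exp (δs ν 5 * L ν) • U ν 5
          else if b = 1 then Real.exp (δs ν 1 * L ν) • U ν 1 + Real.exp (δs ν 4 * L ν) • U ν 4
          else if b = 4 then (δs ν 4 - δs ν 1) • (Real.exp (δs ν 4 * L ν) • U ν 4)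
          else if b = 5 then (δs ν 5 - δs ν 0) • (Real.exp (δs ν 5 * L ν) • U ν 5) else Real.exp (δs ν b * L ν) • U ν b)| ≤ μ' ν) →
      ∀ (Γ Γ' : Fin 6 → Fin 6 → ℝ),
      (∀ a b, Tendsto (fun ν => polar (if a = 0 then U ν 0 + U ν 5 else if a = 1 then U ν 1 + U ν 4
          else if a = 4 then (δs ν 4 - δs ν 1) • U ν 4 else if a = 5 then (δs ν 5 - δs ν 0) • U ν 5 else U ν a)
        (if b = 0 then U ν 0 + U ν 5 else if b = 1 then U ν 1 + U ν 4
          else if b = 4 then (δs ν 4 - δs ν 1) • U ν 4 else if b = 5 then (δs ν 5 - δs ν 0) • U ν 5 else U ν b) / μ ν) atTop (𝓝 (Γ a b))) →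
      (∀ a b, Tendsto (fun ν => polar (if a = 0 then Real.exp (δs ν 0 * L ν) • U ν 0 + Real.exp (δs ν 5 * L ν) • U ν 5
          else if a = 1 then Real.exp (δs ν 1 * L ν) • U ν 1 + Real.exp (δs ν 4 * L ν) • U ν 4
          else if a = 4 then (δs ν 4 - δs ν 1) • (Real.exp (δs ν 4 * L ν) • U ν 4)
          else if a = 5 then (δs ν 5 - δs ν 0) • (Real.exp (δs ν 5 * L ν) • U ν 5) else Real.exp (δs ν a * L ν) • U ν a)
        (if b = 0 then Real.exp (δs ν 0 * L ν) • U ν 0 + Real.exp (δs ν 5 * L ν) • U ν 5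
          else if b = 1 then Real.exp (δs ν 1 * L ν) • U ν 1 + Real.exp (δs ν 4 * L ν) • U ν 4
          else if b = 4 then (δs ν 4 - δs ν 1) • (Real.exp (δs ν 4 * L ν) • U ν 4)
          else if b = 5 then (δs ν 5 - δs ν 0) • (Real.exp (δs ν 5 * L ν) • U ν 5) else Real.exp (δs ν b * L ν) • U ν b) / μ' ν) atTop (𝓝 (Γ' a b))) →
      (Γ 0 4 ≠ 0 ∨ Γ 5 1 ≠ 0) → Γ' 5 4 = 0)
    (hMixThree : ∀ (δs : ℕ → Fin 6 → ℝ), (∀ l, Tendsto (fun ν => δs ν l) atTop (𝓝 (δ0 l))) →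
      ∀ (U : ℕ → Fin 6 → Matrix (Fin 2) (Fin 2) ℝ) (L₁ L₂ : ℕ → ℝ), Tendsto L₁ atTop atTop → Tendsto L₂ atTop atTop →
      ∀ (μ₁ μ₂ μ₃ : ℕ → ℝ), (∀ ν, 0 < μ₁ ν) → (∀ ν, 0 < μ₂ ν) → (∀ ν, 0 < μ₃ ν) →
      (∀ ν a b, |polar (if a = 0 then U ν 0 + U ν 5 else if a = 1 then U ν 1 + U ν 4
          else if a = 4 then (δs ν 4 - δs ν 1) • U ν 4 else if a = 5 then (δs ν 5 - δs ν 0) • U ν 5 else U ν a)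
        (if b = 0 then U ν 0 + U ν 5 else if b = 1 then U ν 1 + U ν 4
          else if b = 4 then (δs ν 4 - δs ν 1) • U ν 4 else if b = 5 then (δs ν 5 - δs ν 0) • U ν 5 else U ν b)| ≤ μ₁ ν) →
      (∀ ν a b, |polar (if a = 0 then Real.exp (δs ν 0 * L₁ ν) • U ν 0 + Real.exp (δs ν 5 * L₁ ν) • U ν 5
          else if a = 1 then Real.exp (δs ν 1 * L₁ ν) • U ν 1 + Real.exp (δs ν 4 * L₁ ν) • U ν 4
          else if a = 4 then (δs ν 4 - δs ν 1) • (Real.exp (δs ν 4 * L₁ ν) • U ν 4)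
          else if a = 5 then (δs ν 5 - δs ν 0) • (Real.exp (δs ν 5 * L₁ ν) • U ν 5) else Real.exp (δs ν a * L₁ ν) • U ν a)
        (if b = 0 then Real.exp (δs ν 0 * L₁ ν) • U ν 0 + Real.exp (δs ν 5 * L₁ ν) • U ν 5
          else if b = 1 then Real.exp (δs ν 1 * L₁ ν) • U ν 1 + Real.exp (δs ν 4 * L₁ ν) • U ν 4
          else if b = 4 then (δs ν 4 - δs ν 1) • (Real.exp (δs ν 4 * L₁ ν) • U ν 4)
          else if b = 5 then (δs ν 5 - δs ν 0) • (Real.exp (δs ν 5 * L₁ ν) • U ν 5) else Real.exp (δs ν b * L₁ ν) • U ν b)| ≤ μ₂ ν) →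
      (∀ ν a b, |polar (if a = 0 then Real.exp (δs ν 0 * (L₁ ν + L₂ ν)) • U ν 0 + Real.exp (δs ν 5 * (L₁ ν + L₂ ν)) • U ν 5
          else if a = 1 then Real.exp (δs ν 1 * (L₁ ν + L₂ ν)) • U ν 1 + Real.exp (δs ν 4 * (L₁ ν + L₂ ν)) • U ν 4
          else if a = 4 then (δs ν 4 - δs ν 1) • (Real.exp (δs ν 4 * (L₁ ν + L₂ ν)) • U ν 4)
          else if a = 5 then (δs ν 5 - δs ν 0) • (Real.exp (δs ν 5 * (L₁ ν + L₂ ν)) • U ν 5) else Real.exp (δs ν a * (L₁ ν + L₂ ν)) • U ν a)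
        (if b = 0 then Real.exp (δs ν 0 * (L₁ ν + L₂ ν)) • U ν 0 + Real.exp (δs ν 5 * (L₁ ν + L₂ ν)) • U ν 5
          else if b = 1 then Real.exp (δs ν 1 * (L₁ ν + L₂ ν)) • U ν 1 + Real.exp (δs ν 4 * (L₁ ν + L₂ ν)) • U ν 4
          else if b = 4 then (δs ν 4 - δs ν 1) • (Real.exp (δs ν 4 * (L₁ ν + L₂ ν)) • U ν 4)
          else if b = 5 then (δs ν 5 - δs ν 0) • (Real.exp (δs ν 5 * (L₁ ν + L₂ ν)) • U ν 5) else Real.exp (δs ν b * (L₁ ν + L₂ ν)) • U ν b)| ≤ μ₃ ν) →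
      ∀ (Γ₁ Γ₂ Γ₃ : Fin 6 → Fin 6 → ℝ),
      (∀ a b, Tendsto (fun ν => polar (if a = 0 then U ν 0 + U ν 5 else if a = 1 then U ν 1 + U ν 4
          else if a = 4 then (δs ν 4 - δs ν 1) • U ν 4 else if a = 5 then (δs ν 5 - δs ν 0) • U ν 5 else U ν a)
        (if b = 0 then U ν 0 + U ν 5 else if b = 1 then U ν 1 + U ν 4
          else if b = 4 then (δs ν 4 - δs ν 1) • U ν 4 else if b = 5 then (δs ν 5 - δs ν 0) • U ν 5 else U ν b) / μ₁ ν) atTop (𝓝 (Γ₁ a b))) →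
      (∀ a b, Tendsto (fun ν => polar (if a = 0 then Real.exp (δs ν 0 * L₁ ν) • U ν 0 + Real.exp (δs ν 5 * L₁ ν) • U ν 5
          else if a = 1 then Real.exp (δs ν 1 * L₁ ν) • U ν 1 + Real.exp (δs ν 4 * L₁ ν) • U ν 4
          else if a = 4 then (δs ν 4 - δs ν 1) • (Real.exp (δs ν 4 * L₁ ν) • U ν 4)
          else if a = 5 then (δs ν 5 - δs ν 0) • (Real.exp (δs ν 5 * L₁ ν) • U ν 5) else Real.exp (δs ν a * L₁ ν) • U ν a)
        (if b = 0 then Real.exp (δs ν 0 * L₁ ν) • U ν 0 + Real.exp (δs ν 5 * L₁ ν) • U ν 5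
          else if b = 1 then Real.exp (δs ν 1 * L₁ ν) • U ν 1 + Real.exp (δs ν 4 * L₁ ν) • U ν 4
          else if b = 4 then (δs ν 4 - δs ν 1) • (Real.exp (δs ν 4 * L₁ ν) • U ν 4)
          else if b = 5 then (δs ν 5 - δs ν 0) • (Real.exp (δs ν 5 * L₁ ν) • U ν 5) else Real.exp (δs ν b * L₁ ν) • U ν b) / μ₂ ν) atTop (𝓝 (Γ₂ a b))) →
      (∀ a b, Tendsto (fun ν => polar (if a = 0 then Real.exp (δs ν 0 * (L₁ ν + L₂ ν)) • U ν 0 + Real.exp (δs ν 5 * (L₁ ν + L₂ ν)) • U ν 5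
          else if a = 1 then Real.exp (δs ν 1 * (L₁ ν + L₂ ν)) • U ν 1 + Real.exp (δs ν 4 * (L₁ ν + L₂ ν)) • U ν 4
          else if a = 4 then (δs ν 4 - δs ν 1) • (Real.exp (δs ν 4 * (L₁ ν + L₂ ν)) • U ν 4)
          else if a = 5 then (δs ν 5 - δs ν 0) • (Real.exp (δs ν 5 * (L₁ ν + L₂ ν)) • U ν 5) else Real.exp (δs ν a * (L₁ ν + L₂ ν)) • U ν a)
        (if b = 0 then Real.exp (δs ν 0 * (L₁ ν + L₂ ν)) • U ν 0 + Real.exp (δs ν 5 * (L₁ ν + L₂ ν)) • U ν 5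
          else if b = 1 then Real.exp (δs ν 1 * (L₁ ν + L₂ ν)) • U ν 1 + Real.exp (δs ν 4 * (L₁ ν + L₂ ν)) • U ν 4
          else if b = 4 then (δs ν 4 - δs ν 1) • (Real.exp (δs ν 4 * (L₁ ν + L₂ ν)) • U ν 4)
          else if b = 5 then (δs ν 5 - δs ν 0) • (Real.exp (δs ν 5 * (L₁ ν + L₂ ν)) • U ν 5) else Real.exp (δs ν b * (L₁ ν + L₂ ν)) • U ν b) / μ₃ ν) atTop (𝓝 (Γ₃ a b))) →
      (Γ₁ 0 4 ≠ 0 ∨ Γ₁ 5 1 ≠ 0) → (Γ₂ 0 4 ≠ 0 ∨ Γ₂ 5 1 ≠ 0) → (Γ₃ 0 4 ≠ 0 ∨ Γ₃ 5 1 ≠ 0) → False)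
    (hG : ∀ a b c e : Fin 4, δ0 a.castSucc.castSucc + δ0 b.castSucc.castSucc = δ0 c.castSucc.castSucc + δ0 e.castSucc.castSucc →
      (a = c ∧ b = e) ∨ (a = e ∧ b = c) ∨
        ((((a = 0 ∧ b = 1) ∨ (a = 1 ∧ b = 0)) ∧ ((c = 2 ∧ e = 3) ∨ (c = 3 ∧ e = 2))) ∨
         (((a = 2 ∧ b = 3) ∨ (a = 3 ∧ b = 2)) ∧ ((c = 0 ∧ e = 1) ∨ (c = 1 ∧ e = 0)))) ∨
        ((((a = 0 ∧ b = 2) ∨ (a = 2 ∧ b = 0)) ∧ ((c = 1 ∧ e = 3) ∨ (c = 3 ∧ e = 1))) ∨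
         (((a = 1 ∧ b = 3) ∨ (a = 3 ∧ b = 1)) ∧ ((c = 0 ∧ e = 2) ∨ (c = 2 ∧ e = 0)))))
    (hnd : ∀ W : Fin 6 → Matrix (Fin 2) (Fin 2) ℝ, (∀ l, (W l).IsSymm) → (∃ p q, polar (W p) (W q) ≠ 0) →
      ∃ t, ((Real.exp (δ0 0 * t)) • (W 0 + t • W 5) + (Real.exp (δ0 1 * t)) • (W 1 + t • W 4)
        + ∑ k : Fin 2, (Real.exp (δ0 k.succ.succ.castSucc.castSucc * t)) • W k.succ.succ.castSucc.castSucc).det ≠ 0)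
    (δs : ℕ → Fin 6 → ℝ) (hδ : ∀ l, Tendsto (fun ν => δs ν l) atTop (𝓝 (δ0 l)))
    (U : ℕ → Fin 6 → Matrix (Fin 2) (Fin 2) ℝ) (hU : ∀ ν l, (U ν l).IsSymm)
    (hne : ∀ ν, ∃ t, (∑ l, Real.exp (δs ν l * t) • U ν l).det ≠ 0)
    (z : ℕ → Fin 20 → ℝ) (hz : ∀ ν, StrictMono (z ν)) (hroot : ∀ ν i, (∑ l, Real.exp (δs ν l * z ν i) • U ν l).det = 0) :
    False := by
  classical
  obtain ⟨φ, hφ, C, m, s, R, hm, hmpos, hdrift, hzeros, μ, Γ, ε, W, hpkg⟩ :=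
    doublyConfluentClusters_of_nondeg δs δ0 hδ h50 h41 hnd U hU hne z hz hroot
  have hμ : ∀ c k, 0 < μ c k := fun c => (hpkg c).1
  have hdom := fun c => (hpkg c).2.1
  have hΓ := fun c => (hpkg c).2.2.1
  have hε : ∀ c, ε c = 1 ∨ ε c = -1 := fun c => (hpkg c).2.2.2.1
  have hΓW : ∀ c a b, Γ c a b = ε c * polar (W c a) (W c b) := fun c => (hpkg c).2.2.2.2.2.1
  have hneW := fun c => (hpkg c).2.2.2.2.2.2.1
  have hconv := fun c => (hpkg c).2.2.2.2.2.2.2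
  have hδφ : ∀ l, Tendsto (fun k => δs (φ k) l) atTop (𝓝 (δ0 l)) := fun l => (hδ l).comp hφ.tendsto_atTop
  -- alive members are the non-zero entries of `Γ`
  have hεne : ∀ c, ε c ≠ 0 := by
    intro c; rcases hε c with h | h <;> rw [h] <;> norm_num
  have hal : ∀ c p q, polar (W c p) (W c q) ≠ 0 ↔ Γ c p q ≠ 0 := by
    intro c p q
    rw [hΓW]
    exact ⟨fun h => mul_ne_zero (hεne c) h, fun h hz0 => h (by rw [hz0, mul_zero])⟩
  have hΓsymm : ∀ c a b, Γ c a b = Γ c b a := by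
    intro c a b; rw [hΓW, hΓW, polar_comm]
  -- the rungs in cluster currency (W1 #51) and the mixed rules, transported
  have Rmono : ∀ c c' : Fin C, c < c' → ∀ p q p' q' : Fin 6, Γ c p q ≠ 0 → Γ c' p' q' ≠ 0 → δ0 p + δ0 q ≤ δ0 p' + δ0 q' :=
    fun c c' hcc' p q p' q' h1 h2 => twoPair_clusters_monotone (fun k => δs (φ k)) δ0 hδφ h50 h41 (fun k => U (φ k)) s μ Γ hμ hdom hΓ
      c c' (hdrift c c' hcc') p q p' q' h1 h2
  have Rdbl05 : ∀ c c' : Fin C, c < c' → ∀ k : Fin 6, k ≠ 0 → k ≠ 1 → k ≠ 4 → k ≠ 5 → Γ c 5 k ≠ 0 → Γ c' 5 k ≠ 0 → False :=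
    fun c c' hcc' k hk0 hk1 hk4 hk5 h1 h2 => twoPair_clusters_doubleton_split₀₅ (fun k => δs (φ k)) δ0 hδφ h50 (fun k => U (φ k)) s μ Γ hμ
      hdom hΓ c c' (hdrift c c' hcc') k hk0 hk1 hk4 hk5 h1 h2
  have Rdbl14 : ∀ c c' : Fin C, c < c' → ∀ k : Fin 6, k ≠ 0 → k ≠ 1 → k ≠ 4 → k ≠ 5 → Γ c 4 k ≠ 0 → Γ c' 4 k ≠ 0 → False :=
    fun c c' hcc' k hk0 hk1 hk4 hk5 h1 h2 => twoPair_clusters_doubleton_split₁₄ (fun k => δs (φ k)) δ0 hδφ h41 (fun k => U (φ k)) s μ Γ hμ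
      hdom hΓ c c' (hdrift c c' hcc') k hk0 hk1 hk4 hk5 h1 h2
  have Rtop05 : ∀ c c' : Fin C, c < c' → Γ c 5 5 ≠ 0 → Γ c' 5 5 = 0 ∧ Γ c' 0 5 = 0 :=
    fun c c' hcc' h1 => twoPair_clusters_triple_top₀₅ (fun k => δs (φ k)) δ0 hδφ h50 (fun k => U (φ k)) s μ Γ hμ hdom hΓ
      c c' (hdrift c c' hcc') h1
  have Rtop14 : ∀ c c' : Fin C, c < c' → Γ c 4 4 ≠ 0 → Γ c' 4 4 = 0 ∧ Γ c' 1 4 = 0 :=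
    fun c c' hcc' h1 => twoPair_clusters_triple_top₁₄ (fun k => δs (φ k)) δ0 hδφ h41 (fun k => U (φ k)) s μ Γ hμ hdom hΓ
      c c' (hdrift c c' hcc') h1
  have Rmid05 : ∀ c c' : Fin C, c < c' → Γ c 0 5 ≠ 0 → Γ c' 5 5 = 0 :=
    fun c c' hcc' h1 => twoPair_clusters_triple_mid₀₅ (fun k => δs (φ k)) δ0 hδφ h50 (fun k => U (φ k)) s μ Γ hμ hdom hΓ
      c c' (hdrift c c' hcc') h1
  have Rmid14 : ∀ c c' : Fin C, c < c' → Γ c 1 4 ≠ 0 → Γ c' 4 4 = 0 :=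
    fun c c' hcc' h1 => twoPair_clusters_triple_mid₁₄ (fun k => δs (φ k)) δ0 hδφ h41 (fun k => U (φ k)) s μ Γ hμ hdom hΓ
      c c' (hdrift c c' hcc') h1
  have Rthree05 : ∀ c₁ c₂ c₃ : Fin C, c₁ < c₂ → c₂ < c₃ → Γ c₁ 0 5 ≠ 0 → Γ c₂ 0 5 ≠ 0 → Γ c₃ 0 5 ≠ 0 → False :=
    fun c₁ c₂ c₃ h12 h23 h1 h2 h3 => twoPair_clusters_triple_three₀₅ (fun k => δs (φ k)) δ0 hδφ h50 (fun k => U (φ k)) s μ Γ hμ hdom hΓ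
      c₁ c₂ c₃ (hdrift c₁ c₂ h12) (hdrift c₂ c₃ h23) h1 h2 h3
  have Rthree14 : ∀ c₁ c₂ c₃ : Fin C, c₁ < c₂ → c₂ < c₃ → Γ c₁ 1 4 ≠ 0 → Γ c₂ 1 4 ≠ 0 → Γ c₃ 1 4 ≠ 0 → False :=
    fun c₁ c₂ c₃ h12 h23 h1 h2 h3 => twoPair_clusters_triple_three₁₄ (fun k => δs (φ k)) δ0 hδφ h41 (fun k => U (φ k)) s μ Γ hμ hdom hΓ
      c₁ c₂ c₃ (hdrift c₁ c₂ h12) (hdrift c₂ c₃ h23) h1 h2 h3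
  have hshift : ∀ (c c' : Fin C) k l, Real.exp (δs (φ k) l * (s c' k - s c k)) • (Real.exp (δs (φ k) l * s c k) • U (φ k) l)
      = Real.exp (δs (φ k) l * s c' k) • U (φ k) l := fun c c' k l => recenter_shift (δs (φ k)) (U (φ k)) (s c k) (s c' k) l
  have hshift' : ∀ (c₁ c₂ c₃ : Fin C) k l, Real.exp (δs (φ k) l * ((s c₂ k - s c₁ k) + (s c₃ k - s c₂ k))) • (Real.exp (δs (φ k) l * s c₁ k) • U (φ k) l)
      = Real.exp (δs (φ k) l * s c₃ k) • U (φ k) l := fun c₁ c₂ c₃ k l => recenter_shift_shift (δs (φ k)) (U (φ k)) (s c₁ k) (s c₂ k) (s c₃ k) l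
  have Mtop : ∀ c c' : Fin C, c < c' → Γ c 5 4 ≠ 0 → Γ c' 5 4 = 0 ∧ Γ c' 0 4 = 0 ∧ Γ c' 5 1 = 0 := by
    intro c c' hcc' h1
    refine hMixTop (fun k => δs (φ k)) hδφ (fun k l => Real.exp (δs (φ k) l * s c k) • U (φ k) l) (fun k => s c' k - s c k)
      (hdrift c c' hcc') (μ c) (μ c') (hμ c) (hμ c') (hdom c) ?_ (Γ c) (Γ c') (hΓ c) ?_ h1
    · intro k a b; simp only [hshift]; exact hdom c' k a b
    · intro a b; simp only [hshift]; exact hΓ c' a b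
  have Mmid : ∀ c c' : Fin C, c < c' → (Γ c 0 4 ≠ 0 ∨ Γ c 5 1 ≠ 0) → Γ c' 5 4 = 0 := by
    intro c c' hcc' h1
    refine hMixMid (fun k => δs (φ k)) hδφ (fun k l => Real.exp (δs (φ k) l * s c k) • U (φ k) l) (fun k => s c' k - s c k)
      (hdrift c c' hcc') (μ c) (μ c') (hμ c) (hμ c') (hdom c) ?_ (Γ c) (Γ c') (hΓ c) ?_ h1
    · intro k a b; simp only [hshift]; exact hdom c' k a b
    · intro a b; simp only [hshift]; exact hΓ c' a b
  have Mthree : ∀ c₁ c₂ c₃ : Fin C, c₁ < c₂ → c₂ < c₃ → (Γ c₁ 0 4 ≠ 0 ∨ Γ c₁ 5 1 ≠ 0) → (Γ c₂ 0 4 ≠ 0 ∨ Γ c₂ 5 1 ≠ 0) →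
      (Γ c₃ 0 4 ≠ 0 ∨ Γ c₃ 5 1 ≠ 0) → False := by
    intro c₁ c₂ c₃ h12 h23 h1 h2 h3
    refine hMixThree (fun k => δs (φ k)) hδφ (fun k l => Real.exp (δs (φ k) l * s c₁ k) • U (φ k) l)
      (fun k => s c₂ k - s c₁ k) (fun k => s c₃ k - s c₂ k) (hdrift c₁ c₂ h12) (hdrift c₂ c₃ h23)
      (μ c₁) (μ c₂) (μ c₃) (hμ c₁) (hμ c₂) (hμ c₃) (hdom c₁) ?_ ?_ (Γ c₁) (Γ c₂) (Γ c₃) (hΓ c₁) ?_ ?_ h1 h2 h3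
    · intro k a b; simp only [hshift]; exact hdom c₂ k a b
    · intro k a b; simp only [hshift']; exact hdom c₃ k a b
    · intro a b; simp only [hshift]; exact hΓ c₂ a b
    · intro a b; simp only [hshift']; exact hΓ c₃ a b
  -- the value set, |V| ≤ 10
  set V : Finset ℝ := ((univ : Finset (Fin 6 × Fin 6)).image (fun pq => δ0 pq.1 + δ0 pq.2)) with hV
  have hmemV : ∀ p q : Fin 6, δ0 p + δ0 q ∈ V := fun p q => Finset.mem_image.mpr ⟨(p, q), Finset.mem_univ _, rfl⟩
  have hV10 : V.card ≤ 10 := by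
    have hsub : V ⊆ (univ : Finset (Fin 4 × Fin 4)).image (fun pr => δ0 pr.1.castSucc.castSucc + δ0 pr.2.castSucc.castSucc) := by
      intro w hw
      rw [hV, Finset.mem_image] at hw
      obtain ⟨pq, -, rfl⟩ := hw
      obtain ⟨a, ha, -⟩ := twoPair_classes δ0 h50 h41 pq.1
      obtain ⟨b, hb, -⟩ := twoPair_classes δ0 h50 h41 pq.2
      exact Finset.mem_image.mpr ⟨(a, b), Finset.mem_univ _, by rw [ha, hb]⟩
    exact (Finset.card_le_card hsub).trans (Bubbling.card_pairSums_four (fun a => δ0 a.castSucc.castSucc)).1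
  -- Σ_V (n w − 1) ≤ 10
  have hn10 : (∑ w ∈ V, ((if (w = δ0 0 + δ0 0 ∨ w = δ0 1 + δ0 1 ∨ w = δ0 0 + δ0 1) then 3
        else if ((w = δ0 0 + δ0 2 ∨ w = δ0 0 + δ0 3) ∧ (w = δ0 1 + δ0 2 ∨ w = δ0 1 + δ0 3)) then 3
        else if (w = δ0 0 + δ0 2 ∨ w = δ0 0 + δ0 3 ∨ w = δ0 1 + δ0 2 ∨ w = δ0 1 + δ0 3) then 2 else 1) - 1)) ≤ 10 := by
    set T : Finset ℝ := {δ0 0 + δ0 0, δ0 1 + δ0 1, δ0 0 + δ0 1} with hT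
    set D0 : Finset ℝ := {δ0 0 + δ0 2, δ0 0 + δ0 3} with hD0
    set D1 : Finset ℝ := {δ0 1 + δ0 2, δ0 1 + δ0 3} with hD1
    have hTc : T.card ≤ 3 := Finset.card_le_three
    have hD0c : D0.card ≤ 2 := Finset.card_le_two
    have hD1c : D1.card ≤ 2 := Finset.card_le_two
    have hterm : ∀ w ∈ V, ((if (w = δ0 0 + δ0 0 ∨ w = δ0 1 + δ0 1 ∨ w = δ0 0 + δ0 1) then 3
        else if ((w = δ0 0 + δ0 2 ∨ w = δ0 0 + δ0 3) ∧ (w = δ0 1 + δ0 2 ∨ w = δ0 1 + δ0 3)) then 3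
        else if (w = δ0 0 + δ0 2 ∨ w = δ0 0 + δ0 3 ∨ w = δ0 1 + δ0 2 ∨ w = δ0 1 + δ0 3) then 2 else 1) - 1)
        ≤ (if w ∈ T then 2 else 0) + (if w ∈ D0 then 1 else 0) + (if w ∈ D1 then 1 else 0) := by
      intro w _
      have hmT : (w = δ0 0 + δ0 0 ∨ w = δ0 1 + δ0 1 ∨ w = δ0 0 + δ0 1) ↔ w ∈ T := by
        rw [hT]; simp only [Finset.mem_insert, Finset.mem_singleton]
      have hmD0 : (w = δ0 0 + δ0 2 ∨ w = δ0 0 + δ0 3) ↔ w ∈ D0 := by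
        rw [hD0]; simp only [Finset.mem_insert, Finset.mem_singleton]
      have hmD1 : (w = δ0 1 + δ0 2 ∨ w = δ0 1 + δ0 3) ↔ w ∈ D1 := by
        rw [hD1]; simp only [Finset.mem_insert, Finset.mem_singleton]
      by_cases h1 : (w = δ0 0 + δ0 0 ∨ w = δ0 1 + δ0 1 ∨ w = δ0 0 + δ0 1)
      · rw [if_pos h1, if_pos (hmT.mp h1)]; omega
      · rw [if_neg h1, if_neg (fun h => h1 (hmT.mpr h))]
        by_cases h2 : ((w = δ0 0 + δ0 2 ∨ w = δ0 0 + δ0 3) ∧ (w = δ0 1 + δ0 2 ∨ w = δ0 1 + δ0 3))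
        · rw [if_pos h2, if_pos (hmD0.mp h2.1), if_pos (hmD1.mp h2.2)]
        · rw [if_neg h2]
          by_cases h3 : (w = δ0 0 + δ0 2 ∨ w = δ0 0 + δ0 3 ∨ w = δ0 1 + δ0 2 ∨ w = δ0 1 + δ0 3)
          · rw [if_pos h3]
            rcases h3 with h3 | h3 | h3 | h3
            · rw [if_pos (hmD0.mp (Or.inl h3))]; split_ifs <;> omega
            · rw [if_pos (hmD0.mp (Or.inr h3))]; split_ifs <;> omega
            · rw [if_pos (hmD1.mp (Or.inl h3))]; split_ifs <;> omega
            · rw [if_pos (hmD1.mp (Or.inr h3))]; split_ifs <;> omega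
          · rw [if_neg h3]; exact Nat.zero_le _
    refine (Finset.sum_le_sum hterm).trans ?_
    rw [Finset.sum_add_distrib, Finset.sum_add_distrib, Finset.sum_boole, Finset.sum_boole, Nat.cast_id, Nat.cast_id]
    have hfT : (V.filter (fun w => w ∈ T)).card ≤ 3 := (Finset.card_le_card (fun w hw => (Finset.mem_filter.mp hw).2)).trans hTc
    have hfD0 : (V.filter (fun w => w ∈ D0)).card ≤ 2 := (Finset.card_le_card (fun w hw => (Finset.mem_filter.mp hw).2)).trans hD0c
    have hfD1 : (V.filter (fun w => w ∈ D1)).card ≤ 2 := (Finset.card_le_card (fun w hw => (Finset.mem_filter.mp hw).2)).trans hD1c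
    have hsumT : (∑ w ∈ V, if w ∈ T then 2 else 0) = 2 * (V.filter (fun w => w ∈ T)).card := by
      rw [Finset.card_eq_sum_ones, Finset.sum_filter, Finset.mul_sum]
      refine Finset.sum_congr rfl fun w _ => ?_
      split_ifs <;> simp
    omega
  -- (hne) every cluster has an alive member
  have hne' : ∀ c : Fin C, (V.filter (fun w => (∃ p q : Fin 6, δ0 p + δ0 q = w ∧ polar (W c p) (W c q) ≠ 0))).Nonempty := by
    intro c
    obtain ⟨p, q, hpq⟩ := exists_polar_ne_zero_of_doublyConfluentDet_ne_zero δ0 (W c) (hneW c)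
    exact ⟨δ0 p + δ0 q, Finset.mem_filter.mpr ⟨hmemV p q, p, q, rfl, hpq⟩⟩
  -- (hcount) the Laguerre–Pólya count per cluster (W1 #37), through the multiplicity transfer
  have hcount : ∀ c : Fin C, m c + 1 ≤ ∑ w ∈ V.filter (fun w => (∃ p q : Fin 6, δ0 p + δ0 q = w ∧ polar (W c p) (W c q) ≠ 0)),
      ((if (∃ p q : Fin 6, δ0 p + δ0 q = w ∧ polar (W c p) (W c q) ≠ 0 ∧ (if p = 5 then 1 else if p = 4 then 1 else 0) + (if q = 5 then 1 else if q = 4 then 1 else 0) = 2) then 2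
          else if (∃ p q : Fin 6, δ0 p + δ0 q = w ∧ polar (W c p) (W c q) ≠ 0 ∧ (if p = 5 then 1 else if p = 4 then 1 else 0) + (if q = 5 then 1 else if q = 4 then 1 else 0) = 1) then 1 else 0) + 1) := by
    intro c
    obtain ⟨Z, mult, hZ, hmZ⟩ := multiplicity_transfer_iteratedDeriv (N := m c) (-R) R
      (fun k t => ε c * (μ c k)⁻¹ * (∑ l, Real.exp (δs (φ k) l * t) • (Real.exp (δs (φ k) l * s c k) • U (φ k) l)).det)
      (fun t => ((Real.exp (δ0 0 * t)) • (W c 0 + t • W c 5) + (Real.exp (δ0 1 * t)) • (W c 1 + t • W c 4)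
          + ∑ k : Fin 2, (Real.exp (δ0 k.succ.succ.castSucc.castSucc * t)) • W c k.succ.succ.castSucc.castSucc).det)
      (fun k nn => contDiff_const.mul (contDiff_pencilDet _ _ nn))
      (fun j _ ψ hψ ts t₀ _ hts => hconv c j ψ hψ ts t₀ hts)
      (fun k => by
        obtain ⟨x, hx, hx'⟩ := hzeros c k
        exact ⟨x, hx, fun i => ⟨(hx' i).1, by rw [(hx' i).2, mul_zero]⟩⟩)
    have hLP := doublyConfluentDet_zerosWithMultiplicityLE_slots δ0 h50 h41 (W c) (hneW c) Z mult
      (fun z' hz' => ⟨Set.mem_univ _, (hZ z' hz').2⟩)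
    have hS1 : 1 ≤ ∑ w ∈ V.filter (fun w => (∃ p q : Fin 6, δ0 p + δ0 q = w ∧ polar (W c p) (W c q) ≠ 0)),
        ((if (∃ p q : Fin 6, δ0 p + δ0 q = w ∧ polar (W c p) (W c q) ≠ 0 ∧ (if p = 5 then 1 else if p = 4 then 1 else 0) + (if q = 5 then 1 else if q = 4 then 1 else 0) = 2) then 2
          else if (∃ p q : Fin 6, δ0 p + δ0 q = w ∧ polar (W c p) (W c q) ≠ 0 ∧ (if p = 5 then 1 else if p = 4 then 1 else 0) + (if q = 5 then 1 else if q = 4 then 1 else 0) = 1) then 1 else 0) + 1) := by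
      obtain ⟨w₀, hw₀⟩ := hne' c
      exact le_trans (Nat.le_add_left 1 _) (Finset.single_le_sum
        (f := fun w => (if (∃ p q : Fin 6, δ0 p + δ0 q = w ∧ polar (W c p) (W c q) ≠ 0 ∧ (if p = 5 then 1 else if p = 4 then 1 else 0) + (if q = 5 then 1 else if q = 4 then 1 else 0) = 2) then 2
          else if (∃ p q : Fin 6, δ0 p + δ0 q = w ∧ polar (W c p) (W c q) ≠ 0 ∧ (if p = 5 then 1 else if p = 4 then 1 else 0) + (if q = 5 then 1 else if q = 4 then 1 else 0) = 1) then 1 else 0) + 1)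
        (fun w _ => Nat.zero_le _) hw₀)
    have hmZ' : m c ≤ ∑ z' ∈ Z, mult z' := hmZ
    have hLP' : ∑ z' ∈ Z, mult z' ≤ (∑ w ∈ V.filter (fun w => (∃ p q : Fin 6, δ0 p + δ0 q = w ∧ polar (W c p) (W c q) ≠ 0)),
        ((if (∃ p q : Fin 6, δ0 p + δ0 q = w ∧ polar (W c p) (W c q) ≠ 0 ∧ (if p = 5 then 1 else if p = 4 then 1 else 0) + (if q = 5 then 1 else if q = 4 then 1 else 0) = 2) then 2
          else if (∃ p q : Fin 6, δ0 p + δ0 q = w ∧ polar (W c p) (W c q) ≠ 0 ∧ (if p = 5 then 1 else if p = 4 then 1 else 0) + (if q = 5 then 1 else if q = 4 then 1 else 0) = 1) then 1 else 0) + 1)) - 1 := hLP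
    omega
  -- (hmono) tropical monotonicity of the active value sets
  have hmono' : ∀ c c' : Fin C, c < c' →
      ∀ w ∈ V.filter (fun w => (∃ p q : Fin 6, δ0 p + δ0 q = w ∧ polar (W c p) (W c q) ≠ 0)), ∀ w' ∈ V.filter (fun w => (∃ p q : Fin 6, δ0 p + δ0 q = w ∧ polar (W c' p) (W c' q) ≠ 0)), w ≤ w' := by
    intro c c' hcc' w hw w' hw'
    obtain ⟨-, p, q, rfl, hpq⟩ := Finset.mem_filter.mp hw
    obtain ⟨-, p', q', rfl, hp'q'⟩ := Finset.mem_filter.mp hw'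
    exact Rmono c c' hcc' p q p' q' ((hal c p q).mp hpq) ((hal c' p' q').mp hp'q')
  -- (hsplit) slot splitting, value by value (W1 #52c/#52d)
  have hsplit : ∀ w ∈ V, (∑ c : Fin C, (if w ∈ V.filter (fun w => (∃ p q : Fin 6, δ0 p + δ0 q = w ∧ polar (W c p) (W c q) ≠ 0))
        then (if (∃ p q : Fin 6, δ0 p + δ0 q = w ∧ polar (W c p) (W c q) ≠ 0 ∧ (if p = 5 then 1 else if p = 4 then 1 else 0) + (if q = 5 then 1 else if q = 4 then 1 else 0) = 2) then 2
          else if (∃ p q : Fin 6, δ0 p + δ0 q = w ∧ polar (W c p) (W c q) ≠ 0 ∧ (if p = 5 then 1 else if p = 4 then 1 else 0) + (if q = 5 then 1 else if q = 4 then 1 else 0) = 1) then 1 else 0) else 0))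
      ≤ (if (w = δ0 0 + δ0 0 ∨ w = δ0 1 + δ0 1 ∨ w = δ0 0 + δ0 1) then 3
        else if ((w = δ0 0 + δ0 2 ∨ w = δ0 0 + δ0 3) ∧ (w = δ0 1 + δ0 2 ∨ w = δ0 1 + δ0 3)) then 3
        else if (w = δ0 0 + δ0 2 ∨ w = δ0 0 + δ0 3 ∨ w = δ0 1 + δ0 2 ∨ w = δ0 1 + δ0 3) then 2 else 1) - 1 := by
    intro w _
    by_cases h1 : (w = δ0 0 + δ0 0 ∨ w = δ0 1 + δ0 1 ∨ w = δ0 0 + δ0 1)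
    · rw [if_pos h1]
      exact (twoPair_hsplit_classes δ0 h50 h41 hG Γ W hal hΓsymm Rtop05 Rtop14 Rmid05 Rmid14 Rthree05 Rthree14 Mtop Mmid Mthree
        w h1).trans (by norm_num)
    · rw [if_neg h1]
      exact twoPair_hsplit_rest δ0 h50 h41 hG Γ W hal hΓsymm Rdbl05 Rdbl14 w h1
  -- the ceiling: `20 = Σ m_c ≤ 10 + (|V| − 1) ≤ 19`
  have hcc := chain_ceiling V (fun w => (if (w = δ0 0 + δ0 0 ∨ w = δ0 1 + δ0 1 ∨ w = δ0 0 + δ0 1) then 3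
        else if ((w = δ0 0 + δ0 2 ∨ w = δ0 0 + δ0 3) ∧ (w = δ0 1 + δ0 2 ∨ w = δ0 1 + δ0 3)) then 3
        else if (w = δ0 0 + δ0 2 ∨ w = δ0 0 + δ0 3 ∨ w = δ0 1 + δ0 2 ∨ w = δ0 1 + δ0 3) then 2 else 1))
    (fun c => V.filter (fun w => (∃ p q : Fin 6, δ0 p + δ0 q = w ∧ polar (W c p) (W c q) ≠ 0)))
    (fun c w => (if (∃ p q : Fin 6, δ0 p + δ0 q = w ∧ polar (W c p) (W c q) ≠ 0 ∧ (if p = 5 then 1 else if p = 4 then 1 else 0) + (if q = 5 then 1 else if q = 4 then 1 else 0) = 2) then 2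
          else if (∃ p q : Fin 6, δ0 p + δ0 q = w ∧ polar (W c p) (W c q) ≠ 0 ∧ (if p = 5 then 1 else if p = 4 then 1 else 0) + (if q = 5 then 1 else if q = 4 then 1 else 0) = 1) then 1 else 0)) m
    hne' (fun c => Finset.filter_subset _ _) hmono' hsplit hcount
  beta_reduce at hcc
  omega

end Summit.ValiantsHypothesis.ValiantsHypothesis.Theorems.LacunarySymmetroidMatrixDescartes.WallBubbling
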